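import Summits.Ventures.HodgeRepro2.T5SplitHermitianPlane
import Summits.Ventures.HodgeRepro2.T5HyperbolicCharacters

/-!
# The doubling `W̃ = W ⊕ W⁻` of a line and the restriction of `ν∘det` to the first factor

Kernel support (seat p3, cell pub-hodge-repro2) behind §F.1 of `route/T5-route-3.md`: «hence
`c(χ) = ν_χ∘det` on `U(W)`, and by restriction along HKS (a.24) (`W̃ := W ⊕ W⁻` split) to
`G(W) = U(V′_v) = E¹_v`: `c_v(χ_v) = ν_{χ_v}`». In the Gram-matrix model of file 82:

* the doubled space of the line `⟨a⟩` (`a` `star`-fixed, `a ≠ 0`) is `doubled a = diag(a, −a)`;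
  it is hermitian, non-degenerate, and SPLIT — `(1, 1)` is isotropic — so by file 82 it has a
  hyperbolic basis and `U(doubled a) ≅ U(ℍ)` (`exists_hyperbolic_basis_doubled`,
  `unitaryEquivDoubled`);
* the determinant on `U(H)` (`detOf`, `detNormOneOf`: its values have norm one because
  `det(gᴴ) det H det g = det H`), and its invariance under the transport of file 82
  (`detOf_unitaryEquivDoubled`);
* the factorisation theorem of file 75 transported to `U(doubled a)`: EVERY character is
  `ν ∘ det` for a unique character `ν` of `E¹` (`exists_factor_det_doubled`);
* the two factors `U(W) = E¹` and `U(W⁻) = E¹` embedded as `diag(t, 1)` and `diag(1, t)`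
  (`firstFactor`, `secondFactor`, with `det = t`), and THE RESTRICTION: a character `ν ∘ det` of
  `U(W̃)` restricts to `ν` on `U(W)` (`comp_firstFactor`), to `ν` on `U(W⁻)`, and to `ν ⊠ ν` on
  `U(W) × U(W⁻)` (`apply_firstFactor_mul_secondFactor`) — the kernel form of «by restriction
  along (a.24) to `G(W) = E¹_v`: `c_v(χ_v) = ν_{χ_v}`».

What stays prose: that HKS's `W̃`, `G(W)` and the splitting `c(χ)` are these objects (the
identification `c(χ) = ν_χ∘det` itself, HKS (1.15) / Lemma 1.3 as printed). Header declaration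
(README §8(d)): uses an L-value-free non-vanishing device: no.
-/

namespace Summit.Ventures.HodgeRepro2.T5DoublingRestriction

open T5UnipotentCommutator T5SplitHermitianPlane T5HyperbolicDet T5HyperbolicCharacters
  T5NormOneCharacters ShimuraData.B3Characters Matrix

variable {E : Type*} [Field E] [StarRing E]

section Doubled

/-- The doubled Gram matrix `W̃ = W ⊕ W⁻` of the line `W = ⟨a⟩`: `diag(a, −a)`. -/
def doubled (a : E) : Matrix (Fin 2) (Fin 2) E := !![a, 0; 0, -a]

/-- `doubled a` is hermitian when `a` is `star`-fixed. -/
theorem conjTranspose_doubled (a : E) (ha : star a = a) : (doubled a)ᴴ = doubled a := by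
  ext i j
  fin_cases i <;> fin_cases j <;> simp [doubled, ha]

omit [StarRing E] in
/-- `det (doubled a) = −a²`. -/
theorem det_doubled (a : E) : (doubled a).det = -(a * a) := by
  simp [doubled, Matrix.det_fin_two_of]

omit [StarRing E] in
/-- `doubled a` is non-degenerate for `a ≠ 0`. -/
theorem det_doubled_ne_zero (a : E) (ha0 : a ≠ 0) : (doubled a).det ≠ 0 := by
  rw [det_doubled]
  exact neg_ne_zero.2 (mul_ne_zero ha0 ha0)

/-- `(1, 1)` is isotropic for `diag(a, −a)`: `a − a = 0`. -/
theorem gramForm_doubled_one_one (a : E) : gramForm (doubled a) ![1, 1] ![1, 1] = 0 := by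
  simp [gramForm_eq_sum, doubled]

omit [StarRing E] in
/-- `(1, 1) ≠ 0`. -/
theorem one_one_ne_zero : (![1, 1] : Fin 2 → E) ≠ 0 := by
  intro h
  have := congrFun h 0
  simp at this

/-- THE DOUBLED SPACE IS SPLIT: `diag(a, −a)` has a hyperbolic basis (file 82 on the isotropic
vector `(1, 1)`). -/
theorem exists_hyperbolic_basis_doubled (hne : ∃ x : E, star x ≠ x) (a : E) (ha : star a = a)
    (ha0 : a ≠ 0) :
    ∃ P : GL (Fin 2) E,
      (P : Matrix (Fin 2) (Fin 2) E)ᴴ * doubled a * (P : Matrix (Fin 2) (Fin 2) E) = hyp :=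
  exists_hyperbolic_basis hne (doubled a) (conjTranspose_doubled a ha) (det_doubled_ne_zero a ha0)
    ![1, 1] one_one_ne_zero (gramForm_doubled_one_one a)

end Doubled

section Det

/-- The determinant on the unitary group of a Gram matrix `H`. -/
def detOf (H : Matrix (Fin 2) (Fin 2) E) : unitaryOf H →* Eˣ :=
  GeneralLinearGroup.det.comp (unitaryOf H).subtype

/-- The determinant as a scalar. -/
theorem coe_detOf (H : Matrix (Fin 2) (Fin 2) E) (g : unitaryOf H) :
    (detOf H g : E) = ((g : GL (Fin 2) E) : Matrix (Fin 2) (Fin 2) E).det :=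
  rfl

/-- For `det H ≠ 0`, `det g` has norm one on `U(H)`: `det(gᴴ)·det H·det g = det H`. -/
theorem star_det_mul_det_of_mem (H : Matrix (Fin 2) (Fin 2) E) (hdet : H.det ≠ 0)
    (g : unitaryOf H) :
    star ((g : GL (Fin 2) E) : Matrix (Fin 2) (Fin 2) E).det *
      ((g : GL (Fin 2) E) : Matrix (Fin 2) (Fin 2) E).det = 1 := by
  have h := (mem_unitaryOf_iff H g).1 g.2
  have := congrArg Matrix.det h
  rw [det_mul, det_mul, det_conjTranspose] at this
  apply mul_left_cancel₀ hdet
  calc H.det * (star ((g : GL (Fin 2) E) : Matrix (Fin 2) (Fin 2) E).det *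
        ((g : GL (Fin 2) E) : Matrix (Fin 2) (Fin 2) E).det)
      = star ((g : GL (Fin 2) E) : Matrix (Fin 2) (Fin 2) E).det * H.det *
          ((g : GL (Fin 2) E) : Matrix (Fin 2) (Fin 2) E).det := by ring
    _ = H.det * 1 := by rw [this, mul_one]

/-- `det g ∈ E¹` for `g ∈ U(H)`, `det H ≠ 0`. -/
theorem detOf_mem_normOne (H : Matrix (Fin 2) (Fin 2) E) (hdet : H.det ≠ 0) (g : unitaryOf H) :
    detOf H g ∈ normOne (unitsConj (starRingAut (R := E))) := by
  change detOf H g * unitsConj starRingAut (detOf H g) = 1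
  apply Units.ext
  rw [Units.val_mul, Units.val_one, mul_comm]
  exact star_det_mul_det_of_mem H hdet g

/-- The determinant `U(H) →* E¹`. -/
def detNormOneOf (H : Matrix (Fin 2) (Fin 2) E) (hdet : H.det ≠ 0) :
    unitaryOf H →* normOne (unitsConj (starRingAut (R := E))) :=
  (detOf H).codRestrict _ (detOf_mem_normOne H hdet)

/-- `detNormOneOf` is `detOf`. -/
theorem coe_detNormOneOf (H : Matrix (Fin 2) (Fin 2) E) (hdet : H.det ≠ 0) (g : unitaryOf H) :
    (detNormOneOf H hdet g : Eˣ) = detOf H g :=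
  rfl

/-- The determinant is invariant under the transport `g ↦ P g P⁻¹` of file 82. -/
theorem detOf_unitaryOfEquiv {H H' : Matrix (Fin 2) (Fin 2) E} (P : GL (Fin 2) E)
    (hP : (P : Matrix (Fin 2) (Fin 2) E)ᴴ * H * P = H') (g : unitaryOf H') :
    detOf H (unitaryOfEquiv P hP g) = detOf H' g := by
  change GeneralLinearGroup.det (P * (g : GL (Fin 2) E) * P⁻¹) = GeneralLinearGroup.det (g : GL (Fin 2) E)
  rw [map_mul, map_mul, map_inv, mul_inv_cancel_comm]

/-- File 74's `detNormOne` on `U(ℍ)` is `detNormOneOf hyp` through `hypUnitary E = unitaryOf hyp`. -/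
theorem detNormOne_eq (g : hypUnitary E) :
    detNormOne g = detNormOneOf hyp (by rw [T5LocalHermitian.det_hyperbolicPlane]; exact neg_ne_zero.2 one_ne_zero)
      (MulEquiv.subgroupCongr hypUnitary_eq_unitaryOf g) :=
  rfl

end Det

section Transport

/-- `U(ℍ) ≅ U(doubled a)` along a hyperbolic basis `P` of `doubled a`. -/
noncomputable def unitaryEquivDoubled (a : E) (P : GL (Fin 2) E)
    (hP : (P : Matrix (Fin 2) (Fin 2) E)ᴴ * doubled a * (P : Matrix (Fin 2) (Fin 2) E) = hyp) :
    hypUnitary E ≃* unitaryOf (doubled a) :=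
  (MulEquiv.subgroupCongr hypUnitary_eq_unitaryOf).trans (unitaryOfEquiv P hP)

/-- The transport is conjugation by `P`. -/
theorem coe_unitaryEquivDoubled (a : E) (P : GL (Fin 2) E)
    (hP : (P : Matrix (Fin 2) (Fin 2) E)ᴴ * doubled a * (P : Matrix (Fin 2) (Fin 2) E) = hyp)
    (g : hypUnitary E) :
    ((unitaryEquivDoubled a P hP g : unitaryOf (doubled a)) : GL (Fin 2) E) = P * g * P⁻¹ :=
  rfl

/-- The determinant is preserved by the transport. -/
theorem detNormOneOf_unitaryEquivDoubled (a : E) (ha0 : a ≠ 0) (P : GL (Fin 2) E)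
    (hP : (P : Matrix (Fin 2) (Fin 2) E)ᴴ * doubled a * (P : Matrix (Fin 2) (Fin 2) E) = hyp)
    (g : hypUnitary E) :
    detNormOneOf (doubled a) (det_doubled_ne_zero a ha0) (unitaryEquivDoubled a P hP g) =
      detNormOne g := by
  apply Subtype.ext
  apply Units.ext
  change ((((unitaryEquivDoubled a P hP g : unitaryOf (doubled a)) : GL (Fin 2) E) :
    Matrix (Fin 2) (Fin 2) E)).det = ((g : GL (Fin 2) E) : Matrix (Fin 2) (Fin 2) E).det
  rw [coe_unitaryEquivDoubled, Units.val_mul, Units.val_mul, det_mul, det_mul]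
  have h1 : ((P⁻¹ : GL (Fin 2) E) : Matrix (Fin 2) (Fin 2) E).det *
      (P : Matrix (Fin 2) (Fin 2) E).det = 1 := by
    rw [← det_mul]
    simp
  calc (P : Matrix (Fin 2) (Fin 2) E).det * ((g : GL (Fin 2) E) : Matrix (Fin 2) (Fin 2) E).det *
        ((P⁻¹ : GL (Fin 2) E) : Matrix (Fin 2) (Fin 2) E).det
      = ((g : GL (Fin 2) E) : Matrix (Fin 2) (Fin 2) E).det *
          (((P⁻¹ : GL (Fin 2) E) : Matrix (Fin 2) (Fin 2) E).det *
            (P : Matrix (Fin 2) (Fin 2) E).det) := by ring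
    _ = ((g : GL (Fin 2) E) : Matrix (Fin 2) (Fin 2) E).det := by rw [h1, mul_one]

variable {M : Type*} [CommGroup M]

/-- THE FACTORISATION THEOREM ON THE DOUBLED SPACE: every character of `U(doubled a)` is `ν ∘ det`
for a character `ν` of `E¹` (file 75 transported along file 82). -/
theorem exists_factor_det_doubled (ha : ∃ x : E, star x ≠ x) (ht : ∃ t : E, t ≠ 0 ∧ t * star t ≠ 1)
    (a : E) (hastar : star a = a) (ha0 : a ≠ 0) (φ : unitaryOf (doubled a) →* M) :
    ∃ ν : normOne (unitsConj (starRingAut (R := E))) →* M,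
      ∀ g : unitaryOf (doubled a), φ g = ν (detNormOneOf (doubled a) (det_doubled_ne_zero a ha0) g) := by
  obtain ⟨P, hP⟩ := exists_hyperbolic_basis_doubled ha a hastar ha0
  obtain ⟨ν, hν⟩ := exists_factor_det ha ht (φ.comp (unitaryEquivDoubled a P hP).toMonoidHom)
  refine ⟨ν, fun g => ?_⟩
  have hg : unitaryEquivDoubled a P hP ((unitaryEquivDoubled a P hP).symm g) = g :=
    (unitaryEquivDoubled a P hP).apply_symm_apply g
  have h1 := hν ((unitaryEquivDoubled a P hP).symm g)
  rw [MonoidHom.comp_apply, MulEquiv.coe_toMonoidHom, hg] at h1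
  rw [h1, ← detNormOneOf_unitaryEquivDoubled a ha0 P hP, hg]

/-- The factor `ν` is unique (the determinant is onto `E¹`). -/
theorem factor_det_doubled_unique (ha : ∃ x : E, star x ≠ x) (a : E) (hastar : star a = a)
    (ha0 : a ≠ 0) (ν₁ ν₂ : normOne (unitsConj (starRingAut (R := E))) →* M)
    (h : ∀ g : unitaryOf (doubled a),
      ν₁ (detNormOneOf (doubled a) (det_doubled_ne_zero a ha0) g) =
        ν₂ (detNormOneOf (doubled a) (det_doubled_ne_zero a ha0) g)) : ν₁ = ν₂ := by
  obtain ⟨P, hP⟩ := exists_hyperbolic_basis_doubled ha a hastar ha0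
  apply factor_det_unique ha
  intro g
  have := h (unitaryEquivDoubled a P hP g)
  rwa [detNormOneOf_unitaryEquivDoubled a ha0 P hP] at this

end Transport

section Factors

/-- The diagonal matrix `diag(t₁, t₂)` as an element of `GL₂(E)`. -/
def diagPair (t₁ t₂ : Eˣ) : GL (Fin 2) E where
  val := !![(t₁ : E), 0; 0, (t₂ : E)]
  inv := !![((t₁⁻¹ : Eˣ) : E), 0; 0, ((t₂⁻¹ : Eˣ) : E)]
  val_inv := by
    ext i j
    fin_cases i <;> fin_cases j <;> simp [Matrix.mul_apply, Fin.sum_univ_two]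
  inv_val := by
    ext i j
    fin_cases i <;> fin_cases j <;> simp [Matrix.mul_apply, Fin.sum_univ_two]

omit [StarRing E] in
/-- The underlying matrix of `diagPair`. -/
theorem coe_diagPair (t₁ t₂ : Eˣ) :
    ((diagPair t₁ t₂ : GL (Fin 2) E) : Matrix (Fin 2) (Fin 2) E) = !![(t₁ : E), 0; 0, (t₂ : E)] :=
  rfl

omit [StarRing E] in
/-- `diagPair` is multiplicative in each entry. -/
theorem diagPair_mul (s₁ s₂ t₁ t₂ : Eˣ) :
    diagPair (s₁ * t₁) (s₂ * t₂) = diagPair s₁ s₂ * diagPair t₁ t₂ := by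
  apply Units.ext
  ext i j
  fin_cases i <;> fin_cases j <;> simp [coe_diagPair, Units.val_mul, Matrix.mul_apply, Fin.sum_univ_two]

omit [StarRing E] in
/-- `diagPair 1 1 = 1`. -/
theorem diagPair_one : diagPair (1 : Eˣ) 1 = 1 := by
  apply Units.ext
  ext i j
  fin_cases i <;> fin_cases j <;> simp [coe_diagPair]

omit [StarRing E] in
/-- `det (diagPair t₁ t₂) = t₁ t₂`. -/
theorem det_diagPair (t₁ t₂ : Eˣ) : GeneralLinearGroup.det (diagPair t₁ t₂) = t₁ * t₂ := by
  apply Units.ext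
  simp [coe_diagPair, Matrix.det_fin_two_of]

/-- `diag(t₁, t₂)` lies in `U(diag(a, −a))` iff both `t_i` have norm one. -/
theorem diagPair_mem_unitaryOf_doubled_iff (a : E) (ha0 : a ≠ 0) (t₁ t₂ : Eˣ) :
    diagPair t₁ t₂ ∈ unitaryOf (doubled a) ↔
      star (t₁ : E) * t₁ = 1 ∧ star (t₂ : E) * t₂ = 1 := by
  rw [mem_unitaryOf_iff, coe_diagPair]
  constructor
  · intro h
    have h00 := congrFun (congrFun h 0) 0
    have h11 := congrFun (congrFun h 1) 1
    simp [doubled, Matrix.mul_apply, Fin.sum_univ_two] at h00 h11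
    constructor
    · have : (star (t₁ : E) * t₁ - 1) * a = 0 := by linear_combination h00
      rcases mul_eq_zero.1 this with h | h
      · exact sub_eq_zero.1 h
      · exact absurd h ha0
    · have : (star (t₂ : E) * t₂ - 1) * a = 0 := by linear_combination h11
      rcases mul_eq_zero.1 this with h | h
      · exact sub_eq_zero.1 h
      · exact absurd h ha0
  · rintro ⟨h1, h2⟩
    ext i j
    fin_cases i <;> fin_cases j <;> simp [doubled, Matrix.mul_apply, Fin.sum_univ_two]
    · linear_combination a * h1
    · linear_combination a * h2

/-- A norm-one `t : E¹` gives `star t * t = 1` in `E`. -/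
theorem star_mul_self_of_mem_normOne (t : normOne (unitsConj (starRingAut (R := E)))) :
    star ((t : Eˣ) : E) * (t : Eˣ) = 1 := by
  have h : (t : Eˣ) * unitsConj starRingAut (t : Eˣ) = 1 := t.2
  have := congrArg Units.val h
  rw [Units.val_mul, Units.val_one] at this
  rw [mul_comm]
  exact this

/-- THE FIRST FACTOR `U(W) = E¹ ↪ U(W̃)`, `t ↦ diag(t, 1)`. -/
def firstFactor (a : E) (ha0 : a ≠ 0) :
    normOne (unitsConj (starRingAut (R := E))) →* unitaryOf (doubled a) where
  toFun t := ⟨diagPair (t : Eˣ) 1,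
    (diagPair_mem_unitaryOf_doubled_iff a ha0 _ _).2
      ⟨star_mul_self_of_mem_normOne t, by simp⟩⟩
  map_one' := by
    apply Subtype.ext
    exact diagPair_one
  map_mul' s t := by
    apply Subtype.ext
    change diagPair ((s : Eˣ) * (t : Eˣ)) 1 = diagPair (s : Eˣ) 1 * diagPair (t : Eˣ) 1
    rw [← diagPair_mul, mul_one]

/-- THE SECOND FACTOR `U(W⁻) = E¹ ↪ U(W̃)`, `t ↦ diag(1, t)`. -/
def secondFactor (a : E) (ha0 : a ≠ 0) :
    normOne (unitsConj (starRingAut (R := E))) →* unitaryOf (doubled a) where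
  toFun t := ⟨diagPair 1 (t : Eˣ),
    (diagPair_mem_unitaryOf_doubled_iff a ha0 _ _).2
      ⟨by simp, star_mul_self_of_mem_normOne t⟩⟩
  map_one' := by
    apply Subtype.ext
    exact diagPair_one
  map_mul' s t := by
    apply Subtype.ext
    change diagPair 1 ((s : Eˣ) * (t : Eˣ)) = diagPair 1 (s : Eˣ) * diagPair 1 (t : Eˣ)
    rw [← diagPair_mul, mul_one]

/-- `diag(t₁, t₂) = diag(t₁, 1) · diag(1, t₂)`: the two factors commute and fill the diagonal. -/
theorem firstFactor_mul_secondFactor (a : E) (ha0 : a ≠ 0)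
    (t₁ t₂ : normOne (unitsConj (starRingAut (R := E)))) :
    ((firstFactor a ha0 t₁ * secondFactor a ha0 t₂ : unitaryOf (doubled a)) : GL (Fin 2) E) =
      diagPair (t₁ : Eˣ) (t₂ : Eˣ) := by
  change diagPair (t₁ : Eˣ) 1 * diagPair 1 (t₂ : Eˣ) = diagPair (t₁ : Eˣ) (t₂ : Eˣ)
  rw [← diagPair_mul, mul_one, one_mul]

/-- `det ∘ firstFactor = id`: «`x(m(t)) = t`» on the first factor. -/
theorem detNormOneOf_firstFactor (a : E) (ha0 : a ≠ 0)
    (t : normOne (unitsConj (starRingAut (R := E)))) :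
    detNormOneOf (doubled a) (det_doubled_ne_zero a ha0) (firstFactor a ha0 t) = t := by
  apply Subtype.ext
  change GeneralLinearGroup.det (diagPair (t : Eˣ) 1) = (t : Eˣ)
  rw [det_diagPair, mul_one]

/-- `det ∘ secondFactor = id`. -/
theorem detNormOneOf_secondFactor (a : E) (ha0 : a ≠ 0)
    (t : normOne (unitsConj (starRingAut (R := E)))) :
    detNormOneOf (doubled a) (det_doubled_ne_zero a ha0) (secondFactor a ha0 t) = t := by
  apply Subtype.ext
  change GeneralLinearGroup.det (diagPair 1 (t : Eˣ)) = (t : Eˣ)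
  rw [det_diagPair, one_mul]

variable {M : Type*} [CommGroup M]

/-- THE RESTRICTION ALONG THE DOUBLING: a character `ν ∘ det` of `U(W̃)` restricts to `ν` on the
first factor `U(W) = E¹` — «`c_v(χ_v) = ν_{χ_v}`». -/
theorem comp_firstFactor (a : E) (ha0 : a ≠ 0) (ν : normOne (unitsConj (starRingAut (R := E))) →* M) :
    (ν.comp (detNormOneOf (doubled a) (det_doubled_ne_zero a ha0))).comp (firstFactor a ha0) = ν := by
  ext t
  simp only [MonoidHom.comp_apply]
  rw [detNormOneOf_firstFactor]

/-- The same on the second factor `U(W⁻)`. -/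
theorem comp_secondFactor (a : E) (ha0 : a ≠ 0)
    (ν : normOne (unitsConj (starRingAut (R := E))) →* M) :
    (ν.comp (detNormOneOf (doubled a) (det_doubled_ne_zero a ha0))).comp (secondFactor a ha0) = ν := by
  ext t
  simp only [MonoidHom.comp_apply]
  rw [detNormOneOf_secondFactor]

/-- On `U(W) × U(W⁻)` the character `ν ∘ det` is `ν ⊠ ν`. -/
theorem apply_firstFactor_mul_secondFactor (a : E) (ha0 : a ≠ 0)
    (ν : normOne (unitsConj (starRingAut (R := E))) →* M)
    (t₁ t₂ : normOne (unitsConj (starRingAut (R := E)))) :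
    ν (detNormOneOf (doubled a) (det_doubled_ne_zero a ha0)
      (firstFactor a ha0 t₁ * secondFactor a ha0 t₂)) = ν t₁ * ν t₂ := by
  rw [map_mul, map_mul, detNormOneOf_firstFactor, detNormOneOf_secondFactor]

/-- EVERY character of `U(W̃)` restricts on the first factor to its own `ν` — the combination of the
factorisation theorem and the restriction: «`c(χ) = ν_χ∘det` on `U(W̃)` gives `c_v(χ_v) = ν_{χ_v}`
on `G(W) = E¹_v`». -/
theorem exists_factor_and_restrict (ha : ∃ x : E, star x ≠ x)
    (ht : ∃ t : E, t ≠ 0 ∧ t * star t ≠ 1) (a : E) (hastar : star a = a) (ha0 : a ≠ 0)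
    (φ : unitaryOf (doubled a) →* M) :
    ∃ ν : normOne (unitsConj (starRingAut (R := E))) →* M,
      (∀ g, φ g = ν (detNormOneOf (doubled a) (det_doubled_ne_zero a ha0) g)) ∧
        φ.comp (firstFactor a ha0) = ν := by
  obtain ⟨ν, hν⟩ := exists_factor_det_doubled ha ht a hastar ha0 φ
  refine ⟨ν, hν, ?_⟩
  ext t
  rw [MonoidHom.comp_apply, hν, detNormOneOf_firstFactor]

end Factors

end Summit.Ventures.HodgeRepro2.T5DoublingRestriction
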